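/-
VALUE = THEOREM (the breadth-first reflection-class certificate run on CODE-TAGGED units, so that
set operations compare one natural number instead of nine matrix entries), NOT summit progress
(cell b2b-lgcu-borel, gen 23); the crux item stmt-MatrixMultiplication-14079 is untouched.
-/
import Mathlib
import Summits.MatrixMultiplication.MatrixMultiplication.Theorems.SubgroupIdentityDesigns.Negative.ReflectionClassCertificateBFS

/-!
# Reflection classes of `GL₃(𝔽_p)`: the breadth-first certificate on code-tagged units

VALUE = THEOREM (generic in `p`), NOT summit progress; the crux item stmt-MatrixMultiplication-14079
is untouched and remains open.

In `ReflectionClassCertificateBFS` the compiled evaluation is dominated by `DecidableEq` on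
`GL₃(𝔽_p)` (nine entries through `Fin`-function closures) inside `Finset` difference / union /
membership: `≈ 8|K|²` comparisons, `1189 s` at `p = 17`.  Here every unit `g` travels as the pair
`tag g = (code g, g)` with `code g < p⁹` its base-`p` entry code, computed ONCE when the pair is
built; pairs compare on the code first (`instDecidableEqProd` short-circuits), so the same search
costs one machine-word comparison per step.  No injectivity of `code` is needed: the pair carries
the unit, and the certificate checks the invariant `e = tag e.2` on the final set, which makes
`Prod.snd` injective there (`snd_injOn`).  Soundness chain as before, with the unit set
`KSP.image Prod.snd`: `KSP_induction`, `KSP_sub`, `KSP_mul_of_step`, `KSP_inv_of`,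
`orbit_sums_ofP` (sum over pairs = sum over units by `Finset.sum_image`), the engine
`PermutationCertificate.no_design_of_permCert`; member forms `no_design_sq_memᵢ_of_certP` /
`no_design_nsq_memᵢ_of_certP` (`m ≥ 3`).

Timings (whole instance file, farm, same generator words as the BFS instances): `p = 13`: 67 s
(BFS layer 256 s), `p = 17`: 222 s (BFS layer 1189 s).
Instances: `SquareReflectionsNineteen` (`p = 19`) and beyond.

HONEST SCOPE.  A reduction; by itself it excludes nothing.
-/

set_option linter.dupNamespace false

open scoped BigOperators Matrix

namespace Summit.MatrixMultiplication.MatrixMultiplication.Theorems.SubgroupIdentityDesigns.Negative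
namespace ReflectionClassCertificateCode

open Summit.MatrixMultiplication.MatrixMultiplication.Theorems.LieRankDesigns.Negative (GLm Mat)
open NonsquareReflections (refl extVec extVec_dotProduct emb_refl)
open SummandTransport (emb design_comap)
open PermutationCertificate (no_design_of_permCert)
open ReflectionClassCertificate (V det3 act act_mul act_one dot_act wt wt_off classGroup)
open ReflectionClassCertificateFast (normF normF_eq table wtab nrm exists_nrm filter_smul)
open ReflectionClassCertificateBFS (gen gens gens_mem)

variable {p : ℕ} [hp : Fact p.Prime]

/-! ## Code-tagged units and the search -/

/-- The base-`p` code of the nine entries of a unit (a natural number `< p⁹`). -/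
def code (g : GLm p 3) : ℕ :=
  ((g : Mat p 3) 0 0).val + p * (((g : Mat p 3) 0 1).val + p * (((g : Mat p 3) 0 2).val +
    p * (((g : Mat p 3) 1 0).val + p * (((g : Mat p 3) 1 1).val + p * (((g : Mat p 3) 1 2).val +
    p * (((g : Mat p 3) 2 0).val + p * (((g : Mat p 3) 2 1).val + p * ((g : Mat p 3) 2 2).val)))))))

/-- A unit tagged with its code. -/
def tag (g : GLm p 3) : ℕ × GLm p 3 := (code g, g)

/-- The tagged pairs. -/
abbrev E (p : ℕ) [Fact p.Prime] := ℕ × GLm p 3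

/-- One frontier step on tagged pairs: `(S, F) ↦ (S ∪ N, N)`, `N = tag (F·G) ∖ S`. -/
def bfsStepP (G : Finset (GLm p 3)) (SF : Finset (E p) × Finset (E p)) :
    Finset (E p) × Finset (E p) :=
  let N := ((SF.2 ×ˢ G).image fun fg => tag (normF (fg.1.2 * fg.2))) \ SF.1
  (SF.1 ∪ N, N)

/-- `d` frontier steps from `({tag 1}, {tag 1})`. -/
def bfsP (G : Finset (GLm p 3)) (d : ℕ) : Finset (E p) × Finset (E p) :=
  (bfsStepP G)^[d] ({tag 1}, {tag 1})

/-- The tagged pairs reached by `d` steps. -/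
def KSP (G : Finset (GLm p 3)) (d : ℕ) : Finset (E p) := (bfsP G d).1

/-- Unfolding one step. -/
theorem bfsP_succ (G : Finset (GLm p 3)) (d : ℕ) : bfsP G (d + 1) = bfsStepP G (bfsP G d) :=
  Function.iterate_succ_apply' _ _ _

/-- `tag 1` is reached. -/
theorem tag_one_mem (G : Finset (GLm p 3)) (d : ℕ) : tag (1 : GLm p 3) ∈ KSP G d := by
  induction d with
  | zero => exact Finset.mem_singleton_self _
  | succ d ih =>
    unfold KSP at ih ⊢
    rw [bfsP_succ]
    exact Finset.mem_union_left _ ih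

/-- The frontier is part of the reached set. -/
theorem frontierP_sub (G : Finset (GLm p 3)) (d : ℕ) : (bfsP G d).2 ⊆ (bfsP G d).1 := by
  induction d with
  | zero => exact subset_rfl
  | succ d _ =>
    rw [bfsP_succ]
    exact Finset.subset_union_right

/-- **Induction over the search** (on the unit component). -/
theorem KSP_induction (G : Finset (GLm p 3)) {P : GLm p 3 → Prop} (h1 : P 1)
    (hmul : ∀ a, P a → ∀ g ∈ G, P (a * g)) : ∀ d, ∀ e ∈ KSP G d, P e.2 := by
  intro d
  induction d with
  | zero =>
    intro e he
    rw [Finset.mem_singleton.mp he]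
    exact h1
  | succ d ih =>
    intro e he
    have he' : e ∈ (bfsP G d).1 ∪
        ((((bfsP G d).2 ×ˢ G).image fun fg => tag (normF (fg.1.2 * fg.2))) \ (bfsP G d).1) := by
      unfold KSP at he
      rwa [bfsP_succ] at he
    rcases Finset.mem_union.mp he' with he' | he'
    · exact ih e he'
    · obtain ⟨fg, hfg, rfl⟩ := Finset.mem_image.mp (Finset.mem_sdiff.mp he').1
      obtain ⟨hf, hg⟩ := Finset.mem_product.mp hfg
      show P (normF (fg.1.2 * fg.2))
      rw [normF_eq]
      exact hmul _ (ih _ (frontierP_sub G d hf)) _ hg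

/-- **The units reached lie in every subgroup containing the generators.** -/
theorem KSP_sub {G : Finset (GLm p 3)} {H : Subgroup (GLm p 3)} (hG : ∀ g ∈ G, g ∈ H)
    (d : ℕ) : ∀ k ∈ (KSP G d).image Prod.snd, k ∈ H := by
  intro k hk
  obtain ⟨e, he, rfl⟩ := Finset.mem_image.mp hk
  exact KSP_induction G H.one_mem (fun _ ha g hg => H.mul_mem ha (hG g hg)) d e he

/-- `1` is among the units reached. -/
theorem one_mem_KSP (G : Finset (GLm p 3)) (d : ℕ) : (1 : GLm p 3) ∈ (KSP G d).image Prod.snd :=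
  Finset.mem_image.mpr ⟨tag 1, tag_one_mem G d, rfl⟩

/-- **Closure under products from the one-step check on tagged pairs.** -/
theorem KSP_mul_of_step {G : Finset (GLm p 3)} {d : ℕ}
    (hst : ((KSP G d ×ˢ G).filter fun eg => ¬ tag (normF (eg.1.2 * eg.2)) ∈ KSP G d) = ∅) :
    ∀ a ∈ (KSP G d).image Prod.snd, ∀ b ∈ (KSP G d).image Prod.snd,
      a * b ∈ (KSP G d).image Prod.snd := by
  have h : ∀ e ∈ KSP G d, ∀ g ∈ G, e.2 * g ∈ (KSP G d).image Prod.snd := fun e he g hg => by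
    have h' := not_not.mp (Finset.filter_eq_empty_iff.mp hst (Finset.mk_mem_product he hg))
    rw [normF_eq] at h'
    exact Finset.mem_image.mpr ⟨_, h', rfl⟩
  have h2 : ∀ a ∈ (KSP G d).image Prod.snd, ∀ g ∈ G, a * g ∈ (KSP G d).image Prod.snd :=
    fun a ha g hg => by
    obtain ⟨e, he, rfl⟩ := Finset.mem_image.mp ha
    exact h e he g hg
  intro a ha b hb
  obtain ⟨e, he, rfl⟩ := Finset.mem_image.mp hb
  exact KSP_induction G (P := fun b => a * b ∈ (KSP G d).image Prod.snd) (by rw [mul_one]; exact ha)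
    (fun b hb g hg => by rw [← mul_assoc]; exact h2 _ hb g hg) d e he

/-- Closure under inverses from the check on tagged pairs. -/
theorem KSP_inv_of {S : Finset (E p)} (hinv : (S.filter fun e => ¬ tag (normF e.2⁻¹) ∈ S) = ∅) :
    ∀ a ∈ S.image Prod.snd, a⁻¹ ∈ S.image Prod.snd := by
  intro a ha
  obtain ⟨e, he, rfl⟩ := Finset.mem_image.mp ha
  have h' := not_not.mp (Finset.filter_eq_empty_iff.mp hinv he)
  rw [normF_eq] at h'
  exact Finset.mem_image.mpr ⟨_, h', rfl⟩

/-- `Prod.snd` is injective on a set of correctly tagged pairs. -/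
theorem snd_injOn {S : Finset (E p)} (htag : ∀ e ∈ S, e = tag e.2) :
    Set.InjOn Prod.snd (S : Set (E p)) := by
  intro e he e' he' h
  rw [htag e he, htag e' he']
  show tag e.2 = tag e'.2
  rw [show e.2 = e'.2 from h]

/-! ## The certificate -/

/-- The orbit test on tagged pairs for one `x`. -/
def orbitTestP (S : Finset (E p)) (Ω : Finset (V p)) (T : Array ℤ) (x : V p) : Bool :=
  let Sx := S.filter fun e => (e.2 : Mat p 3) *ᵥ x = x
  decide ((Ω.filter fun ω => (∑ e ∈ Sx, wtab T (act e.2 ω)) ≠ 0) = ∅)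

/-- **The certificate on tagged pairs** (`S = KSP (gens ws) d`, `G = gens ws` in the soundness
theorem): generator words of class-`σ` vectors; tags correct; `S·G ⊆ S`; `S⁻¹ ⊆ S`; orthogonal
with `det² = 1`; `w(X₀) ≠ 0`; weight table correct; orbit test for every scalar representative. -/
def certP (S : Finset (E p)) (G : Finset (GLm p 3)) (σ : Bool) (ws : List (List (V p)))
    (c : ZMod p) (X₀ : V p) : Bool :=
  let Ω := (Finset.univ : Finset (V p)).filter fun ω => ω ⬝ᵥ ω = c
  let T := table c X₀
  decide (∀ w ∈ ws, ∀ b ∈ w, b ⬝ᵥ b ≠ 0 ∧ decide (IsSquare (b ⬝ᵥ b)) = σ) &&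
  (decide ((S.filter fun e => ¬ e = tag e.2) = ∅) &&
  (decide (((S ×ˢ G).filter fun eg => ¬ tag (normF (eg.1.2 * eg.2)) ∈ S) = ∅) &&
  (decide ((S.filter fun e => ¬ tag (normF e.2⁻¹) ∈ S) = ∅) &&
  (decide ((S.filter fun e : E p => ¬ (((e.2 : Mat p 3))ᵀ * (e.2 : Mat p 3) = 1 ∧
    det3 (e.2 : Mat p 3) * det3 (e.2 : Mat p 3) = 1)) = ∅) &&
  (decide (wt c X₀ X₀ ≠ 0) &&
  (decide (∀ v : V p, wtab T v = wt c X₀ v) &&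
  decide (∀ x : V p, nrm x = true → orbitTestP S Ω T x = true)))))))

/-- Unpacking the certificate. -/
theorem certP_spec {S : Finset (E p)} {G : Finset (GLm p 3)} {σ : Bool} {ws : List (List (V p))}
    {c : ZMod p} {X₀ : V p} (h : certP S G σ ws c X₀ = true) :
    (∀ w ∈ ws, ∀ b ∈ w, b ⬝ᵥ b ≠ 0 ∧ decide (IsSquare (b ⬝ᵥ b)) = σ) ∧
    (S.filter fun e => ¬ e = tag e.2) = ∅ ∧
    ((S ×ˢ G).filter fun eg => ¬ tag (normF (eg.1.2 * eg.2)) ∈ S) = ∅ ∧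
    (S.filter fun e => ¬ tag (normF e.2⁻¹) ∈ S) = ∅ ∧
    (S.filter fun e : E p => ¬ (((e.2 : Mat p 3))ᵀ * (e.2 : Mat p 3) = 1 ∧
      det3 (e.2 : Mat p 3) * det3 (e.2 : Mat p 3) = 1)) = ∅ ∧
    wt c X₀ X₀ ≠ 0 ∧ (∀ v : V p, wtab (table c X₀) v = wt c X₀ v) ∧
    (∀ x : V p, nrm x = true → orbitTestP S
      ((Finset.univ : Finset (V p)).filter fun ω => ω ⬝ᵥ ω = c) (table c X₀) x = true) := by
  unfold certP at h
  simp only [Bool.and_eq_true, decide_eq_true_eq] at h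
  exact ⟨h.1, h.2.1, h.2.2.1, h.2.2.2.1, h.2.2.2.2.1, h.2.2.2.2.2.1, h.2.2.2.2.2.2.1, h.2.2.2.2.2.2.2⟩

/-- The stabiliser orbit sums over the UNITS vanish, from the test on tagged pairs. -/
theorem orbit_sums_ofP {S : Finset (E p)} {c : ZMod p} {X₀ : V p}
    (htag : (S.filter fun e => ¬ e = tag e.2) = ∅)
    (horth : (S.filter fun e : E p => ¬ (((e.2 : Mat p 3))ᵀ * (e.2 : Mat p 3) = 1 ∧
      det3 (e.2 : Mat p 3) * det3 (e.2 : Mat p 3) = 1)) = ∅)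
    (htab : ∀ v : V p, wtab (table c X₀) v = wt c X₀ v)
    (htest : ∀ x : V p, nrm x = true → orbitTestP S
      ((Finset.univ : Finset (V p)).filter fun ω => ω ⬝ᵥ ω = c) (table c X₀) x = true) :
    ∀ x : V p, x ≠ 0 → ∀ ω : V p,
      (∑ s ∈ (S.image Prod.snd).filter (fun s : GLm p 3 => (s : Mat p 3) *ᵥ x = x),
        wt c X₀ (act s ω)) = 0 := by
  have htag' : ∀ e ∈ S, e = tag e.2 := fun e he =>
    not_not.mp (Finset.filter_eq_empty_iff.mp htag he)
  -- sum over units of the stabiliser = sum over tagged pairs of the stabiliser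
  have hsum : ∀ (y : V p) (ω : V p),
      (∑ s ∈ (S.image Prod.snd).filter (fun s : GLm p 3 => (s : Mat p 3) *ᵥ y = y),
        wt c X₀ (act s ω)) =
      ∑ e ∈ S.filter (fun e => (e.2 : Mat p 3) *ᵥ y = y), wt c X₀ (act e.2 ω) := by
    intro y ω
    rw [Finset.filter_image, Finset.sum_image]
    exact fun e he e' he' h => snd_injOn htag' (Finset.mem_filter.mp he).1
      (Finset.mem_filter.mp he').1 h
  intro x hx ω
  obtain ⟨t, ht, hN⟩ := exists_nrm x hx
  rw [← filter_smul _ ht x, hsum]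
  by_cases hω : ω ⬝ᵥ ω = c
  · have h := htest (t • x) hN
    unfold orbitTestP at h
    simp only [decide_eq_true_eq] at h
    have h' := Finset.filter_eq_empty_iff.mp h (Finset.mem_filter.mpr ⟨Finset.mem_univ ω, hω⟩)
    simp only [htab, not_not] at h'
    exact h'
  · refine Finset.sum_eq_zero fun e he => wt_off ?_
    have hk := not_not.mp (Finset.filter_eq_empty_iff.mp horth (Finset.mem_filter.mp he).1)
    rwa [dot_act hk.1 hk.2]

/-! ## The exclusions -/

section Exclusions

variable {σ : Bool} {ws : List (List (V p))} {d : ℕ} {c : ZMod p} {X₀ : V p} {m : ℕ}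

/-- **Soundness**: once `certP (KSP (gens ws) d) (gens ws) σ ws c X₀ = true`, no triple whose
product set covers the class subgroup minus `1` carries a level-one identity design. -/
theorem no_design_of_certP {H₁ H₂ H₃ : Subgroup (GLm p 3)}
    (hc : certP (KSP (gens ws) d) (gens ws) σ ws c X₀ = true)
    (hmem : ∀ k ∈ classGroup p σ, k ≠ 1 → ∃ a ∈ H₁, ∃ b ∈ H₂, ∃ g ∈ H₃, a * b * g = k) :
    ¬ ∃ f : Mat p 3 → ℂ, (∀ M, 1 < M.rank → f M = 0) ∧
      (∑ M, f M * ZMod.stdAddChar (Matrix.trace (M * ((1 : GLm p 3) : Mat p 3)))) = 1 ∧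
      ∀ a ∈ H₁, ∀ b ∈ H₂, ∀ g ∈ H₃, a * b * g ≠ 1 →
        (∑ M, f M * ZMod.stdAddChar (Matrix.trace (M * ((a * b * g : GLm p 3) : Mat p 3)))) = 0 :=
  by
  have hc' := certP_spec hc
  exact no_design_of_permCert ((KSP (gens ws) d).image Prod.snd) (one_mem_KSP _ d)
    (KSP_mul_of_step hc'.2.2.1) (KSP_inv_of hc'.2.2.2.1) act act_mul act_one (wt c X₀)
    ⟨X₀, hc'.2.2.2.2.2.1⟩
    (orbit_sums_ofP hc'.2.1 hc'.2.2.2.2.1 hc'.2.2.2.2.2.2.1 hc'.2.2.2.2.2.2.2)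
    fun k hk hk1 => hmem k (KSP_sub (gens_mem (H := classGroup p σ)
      (fun b hb0 hb => Subgroup.subset_closure ⟨b, hb0, hb, rfl⟩) hc'.1) d k hk) hk1

/-- **SQUARE CLASS: once `certP (KSP (gens ws) d) (gens ws) true ws c X₀ = true` is evaluated,
NO MEMBER OF A TRIPLE IN `GL_m(𝔽_p)`, `m ≥ 3`, CONTAINS ALL SQUARE REFLECTIONS of `𝔽_p^m`**
(three coordinates suffice): member `1`. -/
theorem no_design_sq_mem₁_of_certP
    (hc : certP (KSP (gens ws) d) (gens ws) true ws c X₀ = true) (hm : 3 ≤ m)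
    {H₁ H₂ H₃ : Subgroup (GLm p m)}
    (h₁ : ∀ b : Fin m → ZMod p, b ⬝ᵥ b ≠ 0 → IsSquare (b ⬝ᵥ b) → refl b ∈ H₁) :
    ¬ ∃ f : Mat p m → ℂ, (∀ M, 1 < M.rank → f M = 0) ∧
      (∑ M, f M * ZMod.stdAddChar (Matrix.trace (M * ((1 : GLm p m) : Mat p m)))) = 1 ∧
      ∀ a ∈ H₁, ∀ b ∈ H₂, ∀ g ∈ H₃, a * b * g ≠ 1 →
        (∑ M, f M * ZMod.stdAddChar (Matrix.trace (M * ((a * b * g : GLm p m) : Mat p m)))) = 0 :=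
  by
  obtain ⟨l, rfl⟩ := Nat.exists_eq_add_of_le hm
  intro hdes
  refine no_design_of_certP (H₁ := H₁.comap (emb finSumFinEquiv))
    (H₂ := H₂.comap (emb finSumFinEquiv)) (H₃ := H₃.comap (emb finSumFinEquiv)) hc
    (triple_of_le₁ ((Subgroup.closure_le _).mpr ?_)) (design_comap finSumFinEquiv 1 hdes)
  rintro _ ⟨b, hb0, hb, rfl⟩
  refine Subgroup.mem_comap.mpr ?_
  rw [emb_refl]
  exact h₁ _ (by rwa [extVec_dotProduct]) (by rw [extVec_dotProduct]; exact of_decide_eq_true hb)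

/-- Square class, member `2`. -/
theorem no_design_sq_mem₂_of_certP
    (hc : certP (KSP (gens ws) d) (gens ws) true ws c X₀ = true) (hm : 3 ≤ m)
    {H₁ H₂ H₃ : Subgroup (GLm p m)}
    (h₂ : ∀ b : Fin m → ZMod p, b ⬝ᵥ b ≠ 0 → IsSquare (b ⬝ᵥ b) → refl b ∈ H₂) :
    ¬ ∃ f : Mat p m → ℂ, (∀ M, 1 < M.rank → f M = 0) ∧
      (∑ M, f M * ZMod.stdAddChar (Matrix.trace (M * ((1 : GLm p m) : Mat p m)))) = 1 ∧
      ∀ a ∈ H₁, ∀ b ∈ H₂, ∀ g ∈ H₃, a * b * g ≠ 1 →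
        (∑ M, f M * ZMod.stdAddChar (Matrix.trace (M * ((a * b * g : GLm p m) : Mat p m)))) = 0 :=
  by
  obtain ⟨l, rfl⟩ := Nat.exists_eq_add_of_le hm
  intro hdes
  refine no_design_of_certP (H₁ := H₁.comap (emb finSumFinEquiv))
    (H₂ := H₂.comap (emb finSumFinEquiv)) (H₃ := H₃.comap (emb finSumFinEquiv)) hc
    (triple_of_le₂ ((Subgroup.closure_le _).mpr ?_)) (design_comap finSumFinEquiv 1 hdes)
  rintro _ ⟨b, hb0, hb, rfl⟩
  refine Subgroup.mem_comap.mpr ?_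
  rw [emb_refl]
  exact h₂ _ (by rwa [extVec_dotProduct]) (by rw [extVec_dotProduct]; exact of_decide_eq_true hb)

/-- Square class, member `3`. -/
theorem no_design_sq_mem₃_of_certP
    (hc : certP (KSP (gens ws) d) (gens ws) true ws c X₀ = true) (hm : 3 ≤ m)
    {H₁ H₂ H₃ : Subgroup (GLm p m)}
    (h₃ : ∀ b : Fin m → ZMod p, b ⬝ᵥ b ≠ 0 → IsSquare (b ⬝ᵥ b) → refl b ∈ H₃) :
    ¬ ∃ f : Mat p m → ℂ, (∀ M, 1 < M.rank → f M = 0) ∧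
      (∑ M, f M * ZMod.stdAddChar (Matrix.trace (M * ((1 : GLm p m) : Mat p m)))) = 1 ∧
      ∀ a ∈ H₁, ∀ b ∈ H₂, ∀ g ∈ H₃, a * b * g ≠ 1 →
        (∑ M, f M * ZMod.stdAddChar (Matrix.trace (M * ((a * b * g : GLm p m) : Mat p m)))) = 0 :=
  by
  obtain ⟨l, rfl⟩ := Nat.exists_eq_add_of_le hm
  intro hdes
  refine no_design_of_certP (H₁ := H₁.comap (emb finSumFinEquiv))
    (H₂ := H₂.comap (emb finSumFinEquiv)) (H₃ := H₃.comap (emb finSumFinEquiv)) hc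
    (triple_of_le₃ ((Subgroup.closure_le _).mpr ?_)) (design_comap finSumFinEquiv 1 hdes)
  rintro _ ⟨b, hb0, hb, rfl⟩
  refine Subgroup.mem_comap.mpr ?_
  rw [emb_refl]
  exact h₃ _ (by rwa [extVec_dotProduct]) (by rw [extVec_dotProduct]; exact of_decide_eq_true hb)

/-- **NON-SQUARE CLASS: once `certP (KSP (gens ws) d) (gens ws) false ws c X₀ = true` is
evaluated, no member of a
triple in `GL_m(𝔽_p)`, `m ≥ 3`, contains all non-square reflections**: member `1`. -/
theorem no_design_nsq_mem₁_of_certP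
    (hc : certP (KSP (gens ws) d) (gens ws) false ws c X₀ = true) (hm : 3 ≤ m)
    {H₁ H₂ H₃ : Subgroup (GLm p m)}
    (h₁ : ∀ b : Fin m → ZMod p, ¬ IsSquare (b ⬝ᵥ b) → refl b ∈ H₁) :
    ¬ ∃ f : Mat p m → ℂ, (∀ M, 1 < M.rank → f M = 0) ∧
      (∑ M, f M * ZMod.stdAddChar (Matrix.trace (M * ((1 : GLm p m) : Mat p m)))) = 1 ∧
      ∀ a ∈ H₁, ∀ b ∈ H₂, ∀ g ∈ H₃, a * b * g ≠ 1 →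
        (∑ M, f M * ZMod.stdAddChar (Matrix.trace (M * ((a * b * g : GLm p m) : Mat p m)))) = 0 :=
  by
  obtain ⟨l, rfl⟩ := Nat.exists_eq_add_of_le hm
  intro hdes
  refine no_design_of_certP (H₁ := H₁.comap (emb finSumFinEquiv))
    (H₂ := H₂.comap (emb finSumFinEquiv)) (H₃ := H₃.comap (emb finSumFinEquiv)) hc
    (triple_of_le₁ ((Subgroup.closure_le _).mpr ?_)) (design_comap finSumFinEquiv 1 hdes)
  rintro _ ⟨b, -, hb, rfl⟩
  refine Subgroup.mem_comap.mpr ?_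
  rw [emb_refl]
  exact h₁ _ (by rw [extVec_dotProduct]; exact of_decide_eq_false hb)

/-- Non-square class, member `2`. -/
theorem no_design_nsq_mem₂_of_certP
    (hc : certP (KSP (gens ws) d) (gens ws) false ws c X₀ = true) (hm : 3 ≤ m)
    {H₁ H₂ H₃ : Subgroup (GLm p m)}
    (h₂ : ∀ b : Fin m → ZMod p, ¬ IsSquare (b ⬝ᵥ b) → refl b ∈ H₂) :
    ¬ ∃ f : Mat p m → ℂ, (∀ M, 1 < M.rank → f M = 0) ∧
      (∑ M, f M * ZMod.stdAddChar (Matrix.trace (M * ((1 : GLm p m) : Mat p m)))) = 1 ∧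
      ∀ a ∈ H₁, ∀ b ∈ H₂, ∀ g ∈ H₃, a * b * g ≠ 1 →
        (∑ M, f M * ZMod.stdAddChar (Matrix.trace (M * ((a * b * g : GLm p m) : Mat p m)))) = 0 :=
  by
  obtain ⟨l, rfl⟩ := Nat.exists_eq_add_of_le hm
  intro hdes
  refine no_design_of_certP (H₁ := H₁.comap (emb finSumFinEquiv))
    (H₂ := H₂.comap (emb finSumFinEquiv)) (H₃ := H₃.comap (emb finSumFinEquiv)) hc
    (triple_of_le₂ ((Subgroup.closure_le _).mpr ?_)) (design_comap finSumFinEquiv 1 hdes)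
  rintro _ ⟨b, -, hb, rfl⟩
  refine Subgroup.mem_comap.mpr ?_
  rw [emb_refl]
  exact h₂ _ (by rw [extVec_dotProduct]; exact of_decide_eq_false hb)

/-- Non-square class, member `3`. -/
theorem no_design_nsq_mem₃_of_certP
    (hc : certP (KSP (gens ws) d) (gens ws) false ws c X₀ = true) (hm : 3 ≤ m)
    {H₁ H₂ H₃ : Subgroup (GLm p m)}
    (h₃ : ∀ b : Fin m → ZMod p, ¬ IsSquare (b ⬝ᵥ b) → refl b ∈ H₃) :
    ¬ ∃ f : Mat p m → ℂ, (∀ M, 1 < M.rank → f M = 0) ∧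
      (∑ M, f M * ZMod.stdAddChar (Matrix.trace (M * ((1 : GLm p m) : Mat p m)))) = 1 ∧
      ∀ a ∈ H₁, ∀ b ∈ H₂, ∀ g ∈ H₃, a * b * g ≠ 1 →
        (∑ M, f M * ZMod.stdAddChar (Matrix.trace (M * ((a * b * g : GLm p m) : Mat p m)))) = 0 :=
  by
  obtain ⟨l, rfl⟩ := Nat.exists_eq_add_of_le hm
  intro hdes
  refine no_design_of_certP (H₁ := H₁.comap (emb finSumFinEquiv))
    (H₂ := H₂.comap (emb finSumFinEquiv)) (H₃ := H₃.comap (emb finSumFinEquiv)) hc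
    (triple_of_le₃ ((Subgroup.closure_le _).mpr ?_)) (design_comap finSumFinEquiv 1 hdes)
  rintro _ ⟨b, -, hb, rfl⟩
  refine Subgroup.mem_comap.mpr ?_
  rw [emb_refl]
  exact h₃ _ (by rw [extVec_dotProduct]; exact of_decide_eq_false hb)

end Exclusions

end ReflectionClassCertificateCode
end Summit.MatrixMultiplication.MatrixMultiplication.Theorems.SubgroupIdentityDesigns.Negative
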